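import Literature.Analysis.FluidPDE.OseenSlice
import Literature.Analysis.FluidPDE.NSBoundedMildOseen
import Literature.Analysis.FluidPDE.KochTataruKernel
import Literature.Analysis.FunctionSpaces.MinkowskiIntegral
import HarnessLib

/-!
# Route `LerayQuarterDissipation`, crux `FiniteDissipationLiouville` (stmt-NavierStokesRegularity-22144)
  — the Oseen Duhamel term of an `L^∞ ∩ L⁶` field is in `L⁶`, with norm `O(√(t − s))`

`--supports stmt-NavierStokesRegularity-22144` (helper). For a jointly measurable field `u` on
`ℝ × ℝ³` with `‖u(σ, ·)‖ ≤ A` and `‖u(σ)‖_{L⁶} ≤ N` for `σ ∈ (s, t)`, the Duhamel term of the Oseen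
(KNSS) integral equation, `B_s(u,u)(t)(x) = ∫_s^t ∫ K(t−σ, x−y)[u(σ,y), u(σ,y)] dy dσ`, satisfies

  `‖B_s(u,u)(t)‖_{L⁶(ℝ³)} ≤ C_B · A · √(t − s) · N`     (`exists_eLpNorm_oseenDuhamel_six_le`)

with an absolute `C_B`: Minkowski's integral inequality (tree
`Literature.Analysis.FunctionSpaces.rpow_inv_lintegral_rpow_lintegral_le`) in `σ`, then once more in
the convolution variable against the Koch–Tataru majorant `C (τ + ‖z‖²)^{-2}` of the kernel (tree
`exists_norm_oseenKernel_le`, Koch–Tataru 2001 (14)), whose `L¹` norm is `C M₀ τ^{-1/2}` (tree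
`integral_add_norm_sq_rpow_neg`), and `∫_s^t (t − σ)^{-1/2} dσ = 2√(t − s)`. This is the `L⁶`
smallness of the Duhamel term on short windows used for the time-continuity in `L⁶` of members of
the finite-dissipation stratum (the input of Chae–Wolf 2017 Thm 1.1 with `p = 6` on its DSS
members). Nothing here bears on Navier–Stokes regularity; no summit is proved.
-/

noncomputable section

open Set MeasureTheory Filter Topology Function Metric Real
open Literature.Analysis Literature.Analysis.FluidPDE Literature.Analysis.FunctionSpaces
open scoped ENNReal NNReal

namespace Summit.NavierStokesRegularity.NavierStokesRegularity.Theorems.FiniteDissipationLiouville.Birth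

-- the problem-side namespace duplicates `NavierStokesRegularity` by design (summit = problem)
set_option linter.dupNamespace false

/-! ### The time weight `∫_s^t (t − σ)^{-1/2} dσ = 2 √(t − s)` -/

/-- `∫_{(s,t)} (t − σ)^{-1/2} dσ = 2 √(t − s)` for `s < t`. -/
theorem integral_Ioo_rpow_neg_half {s t : ℝ} (hst : s < t) :
    ∫ σ in Ioo s t, (t - σ) ^ (-(1 / 2 : ℝ)) = 2 * Real.sqrt (t - s) := by
  rw [← integral_Ioc_eq_integral_Ioo, ← intervalIntegral.integral_of_le hst.le,
    intervalIntegral.integral_comp_sub_left (fun x : ℝ => x ^ (-(1 / 2 : ℝ))) t]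
  rw [sub_self, integral_rpow (Or.inl (by norm_num))]
  have e3 : (-(1 / 2 : ℝ)) + 1 = 1 / 2 := by norm_num
  rw [e3, Real.zero_rpow (by norm_num), sub_zero, Real.sqrt_eq_rpow]
  ring

/-- The weight `σ ↦ (t − σ)^{-1/2}` is integrable on `(s, t)`. -/
theorem integrableOn_Ioo_rpow_neg_half {s t : ℝ} (hst : s < t) :
    IntegrableOn (fun σ : ℝ => (t - σ) ^ (-(1 / 2 : ℝ))) (Ioo s t) := by
  have hII : IntervalIntegrable (fun x : ℝ => x ^ (-(1 / 2 : ℝ))) volume (t - s) 0 :=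
    intervalIntegral.intervalIntegrable_rpow' (by norm_num)
  have hc := hII.comp_sub_left t
  rw [sub_sub_cancel, sub_zero] at hc
  exact (intervalIntegrable_iff_integrableOn_Ioo_of_le hst.le).1 hc

/-! ### One slice: `‖N_τ[a, a]‖_{L⁶} ≤ C M₀ τ^{-1/2} A ‖a‖_{L⁶}` -/

/-- **`L^∞ × L⁶ → L⁶` bound of one Duhamel slice** (Minkowski's integral inequality against the
parabolic majorant of the Oseen kernel): if `‖K(τ,z)[b,c]‖ ≤ C (τ + ‖z‖²)^{-2}‖b‖‖c‖` and
`a : ℝ³ → ℝ³` is measurable with `‖a‖ ≤ A`, then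
`‖x ↦ ∫ K(τ, x − y)[a y, a y] dy‖_{L⁶} ≤ C A (∫ (τ + ‖z‖²)^{-2} dz) ‖a‖_{L⁶}`. -/
theorem eLpNorm_oseenSlice_six_le {C : ℝ} (hC : 0 ≤ C)
    (hK : ∀ {τ : ℝ}, 0 < τ → ∀ z b c : EuclideanSpace ℝ (Fin 3),
      ‖oseenKernel τ z b c‖ ≤ C * (τ + ‖z‖ ^ 2) ^ (-(2 : ℝ)) * ‖b‖ * ‖c‖)
    {τ : ℝ} (hτ : 0 < τ) {a : EuclideanSpace ℝ (Fin 3) → EuclideanSpace ℝ (Fin 3)}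
    (ham : Measurable a) {A : ℝ} (hA : ∀ y, ‖a y‖ ≤ A) :
    eLpNorm (fun x => ∫ y, oseenKernel τ (x - y) (a y) (a y)) 6 volume ≤
      ENNReal.ofReal (C * A * ∫ z : EuclideanSpace ℝ (Fin 3), (τ + ‖z‖ ^ 2) ^ (-(2 : ℝ))) *
        eLpNorm a 6 volume := by
  have hA0 : 0 ≤ A := (norm_nonneg _).trans (hA 0)
  -- the majorant `Φ(z) = C A (τ + ‖z‖²)^{-2}` in `ℝ≥0∞`
  set Φ : EuclideanSpace ℝ (Fin 3) → ℝ≥0∞ :=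
    fun z => ENNReal.ofReal (C * A * (τ + ‖z‖ ^ 2) ^ (-(2 : ℝ))) with hΦ
  have hΦm : Measurable Φ := by
    refine ENNReal.measurable_ofReal.comp ?_
    exact measurable_const.mul ((Continuous.rpow_const (by fun_prop) fun z => Or.inl
      (by positivity)).measurable)
  have ham' : Measurable fun y => ‖a y‖ₑ := ham.enorm
  -- pointwise: `‖N(x)‖ₑ ≤ ∫⁻ z, Φ z * ‖a (x - z)‖ₑ`
  have hpt : ∀ x, ‖∫ y, oseenKernel τ (x - y) (a y) (a y)‖ₑ ≤ ∫⁻ z, Φ z * ‖a (x - z)‖ₑ := by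
    intro x
    refine (enorm_integral_le_lintegral_enorm _).trans ?_
    have hsub : ∫⁻ z, Φ z * ‖a (x - z)‖ₑ = ∫⁻ y, Φ (x - y) * ‖a y‖ₑ := by
      rw [← lintegral_sub_left_eq_self (fun y => Φ (x - y) * ‖a y‖ₑ) x]
      refine lintegral_congr fun z => ?_
      simp only [sub_sub_cancel]
    rw [hsub]
    refine lintegral_mono fun y => ?_
    have h1 := hK hτ (x - y) (a y) (a y)
    have hw0 : 0 ≤ C * (τ + ‖x - y‖ ^ 2) ^ (-(2 : ℝ)) := mul_nonneg hC (Real.rpow_nonneg (by positivity) _)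
    calc ‖oseenKernel τ (x - y) (a y) (a y)‖ₑ
        = ENNReal.ofReal ‖oseenKernel τ (x - y) (a y) (a y)‖ := (ofReal_norm _).symm
      _ ≤ ENNReal.ofReal (C * A * (τ + ‖x - y‖ ^ 2) ^ (-(2 : ℝ)) * ‖a y‖) := by
          refine ENNReal.ofReal_le_ofReal ?_
          calc ‖oseenKernel τ (x - y) (a y) (a y)‖
              ≤ C * (τ + ‖x - y‖ ^ 2) ^ (-(2 : ℝ)) * ‖a y‖ * ‖a y‖ := h1
            _ ≤ C * (τ + ‖x - y‖ ^ 2) ^ (-(2 : ℝ)) * A * ‖a y‖ := by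
                gcongr
                exact hA y
            _ = C * A * (τ + ‖x - y‖ ^ 2) ^ (-(2 : ℝ)) * ‖a y‖ := by ring
      _ = Φ (x - y) * ‖a y‖ₑ := by
          rw [ENNReal.ofReal_mul (by positivity), ofReal_norm]
  -- Minkowski in the convolution variable
  have h6 : (6 : ℝ≥0∞).toReal = 6 := by norm_num
  have hmeas : Measurable (uncurry fun (x z : EuclideanSpace ℝ (Fin 3)) => Φ z * ‖a (x - z)‖ₑ) :=
    (hΦm.comp measurable_snd).mul (ham'.comp (measurable_fst.sub measurable_snd))
  have hMink := rpow_inv_lintegral_rpow_lintegral_le (μ := (volume : Measure (EuclideanSpace ℝ (Fin 3))))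
    (ν := (volume : Measure (EuclideanSpace ℝ (Fin 3)))) (p := (6 : ℝ)) (by norm_num) hmeas
  -- the inner integrals: `(∫⁻_x (Φ z ‖a(x−z)‖ₑ)^6)^{1/6} = Φ z · ‖a‖₆`
  have hinner : ∀ z, (∫⁻ x, (Φ z * ‖a (x - z)‖ₑ) ^ (6 : ℝ)) ^ (1 / (6 : ℝ)) =
      Φ z * eLpNorm a 6 volume := by
    intro z
    have e1 : ∫⁻ x, (Φ z * ‖a (x - z)‖ₑ) ^ (6 : ℝ) = Φ z ^ (6 : ℝ) * ∫⁻ x, ‖a x‖ₑ ^ (6 : ℝ) := by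
      simp_rw [ENNReal.mul_rpow_of_nonneg _ _ (by norm_num : (0 : ℝ) ≤ 6)]
      rw [lintegral_const_mul' _ _ (ENNReal.rpow_ne_top_of_nonneg (by norm_num) ENNReal.ofReal_ne_top),
        lintegral_sub_right_eq_self (fun x => ‖a x‖ₑ ^ (6 : ℝ)) z]
    rw [e1, ENNReal.mul_rpow_of_nonneg _ _ (by norm_num : (0 : ℝ) ≤ 1 / 6), one_div,
      ENNReal.rpow_rpow_inv (by norm_num), eLpNorm_eq_lintegral_rpow_enorm_toReal (by norm_num)
        (by norm_num), h6, one_div]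
  calc eLpNorm (fun x => ∫ y, oseenKernel τ (x - y) (a y) (a y)) 6 volume
      = (∫⁻ x, ‖∫ y, oseenKernel τ (x - y) (a y) (a y)‖ₑ ^ (6 : ℝ)) ^ (1 / (6 : ℝ)) := by
        rw [eLpNorm_eq_lintegral_rpow_enorm_toReal (by norm_num) (by norm_num), h6]
    _ ≤ (∫⁻ x, (∫⁻ z, Φ z * ‖a (x - z)‖ₑ) ^ (6 : ℝ)) ^ (1 / (6 : ℝ)) := by
        gcongr with x
        exact hpt x
    _ ≤ ∫⁻ z, (∫⁻ x, (Φ z * ‖a (x - z)‖ₑ) ^ (6 : ℝ)) ^ (1 / (6 : ℝ)) := hMink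
    _ = ∫⁻ z, Φ z * eLpNorm a 6 volume := lintegral_congr hinner
    _ = (∫⁻ z, Φ z) * eLpNorm a 6 volume := by rw [lintegral_mul_const _ hΦm]
    _ = ENNReal.ofReal (C * A * ∫ z : EuclideanSpace ℝ (Fin 3), (τ + ‖z‖ ^ 2) ^ (-(2 : ℝ))) *
          eLpNorm a 6 volume := by
        congr 1
        have he2 : ((Module.finrank ℝ (EuclideanSpace ℝ (Fin 3)) : ℕ) : ℝ) < 2 * 2 := by
          rw [finrank_euclideanSpace_fin]; norm_num
        have hint : Integrable (fun z : EuclideanSpace ℝ (Fin 3) => (τ + ‖z‖ ^ 2) ^ (-(2 : ℝ))) :=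
          integrable_add_norm_sq_rpow_neg he2 hτ
        rw [hΦ, ← ofReal_integral_eq_lintegral_ofReal (hint.const_mul _)
          (Eventually.of_forall fun z => by positivity), integral_const_mul]

/-! ### The Duhamel term: Minkowski in the time variable -/

/-- **`‖B_s(u,u)(t)‖_{L⁶} ≤ C_B A √(t − s) · sup_σ ‖u(σ)‖_{L⁶}`** for a jointly measurable field
`u` with `‖u(σ, ·)‖ ≤ A` and `‖u(σ)‖_{L⁶} ≤ N` on `(s, t)` (Minkowski's integral inequality in `σ`,
the slice bound `eLpNorm_oseenSlice_six_le`, `‖(τ + ‖·‖²)^{-2}‖₁ = M₀ τ^{-1/2}` and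
`∫_s^t (t − σ)^{-1/2} dσ = 2√(t − s)`). -/
theorem exists_eLpNorm_oseenDuhamel_six_le :
    ∃ CB : ℝ, 0 < CB ∧ ∀ {u : ℝ → EuclideanSpace ℝ (Fin 3) → EuclideanSpace ℝ (Fin 3)},
      Measurable (uncurry u) → ∀ {s t A : ℝ}, s < t → (∀ σ ∈ Ioo s t, ∀ y, ‖u σ y‖ ≤ A) →
      ∀ {N : ℝ≥0∞}, (∀ σ ∈ Ioo s t, eLpNorm (u σ) 6 volume ≤ N) →
      eLpNorm (oseenDuhamel 1 s u u t) 6 volume ≤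
        ENNReal.ofReal (CB * A * Real.sqrt (t - s)) * N := by
  obtain ⟨C, hC, hK⟩ := exists_norm_oseenKernel_le (E := EuclideanSpace ℝ (Fin 3))
  set M₀ : ℝ := ∫ w : EuclideanSpace ℝ (Fin 3), (1 + ‖w‖ ^ 2) ^ (-(2 : ℝ)) with hM₀
  have hM₀0 : 0 ≤ M₀ := integral_nonneg fun w => Real.rpow_nonneg (by positivity) _
  refine ⟨2 * C * M₀ + 1, by positivity, ?_⟩
  intro u hum s t A hst hbd N hN
  have hK' : ∀ {τ : ℝ}, 0 < τ → ∀ z b c : EuclideanSpace ℝ (Fin 3),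
      ‖oseenKernel τ z b c‖ ≤ C * (τ + ‖z‖ ^ 2) ^ (-(2 : ℝ)) * ‖b‖ * ‖c‖ := by
    intro τ hτ z b c
    have h := hK hτ z b c
    have e : (-((((Module.finrank ℝ (EuclideanSpace ℝ (Fin 3)) : ℕ) : ℝ) + 1) / 2)) = -(2 : ℝ) := by
      rw [finrank_euclideanSpace_fin]; norm_num
    rw [e] at h
    exact h
  have hσ₀ : (s + t) / 2 ∈ Ioo s t := ⟨by linarith, by linarith⟩
  have hA0 : 0 ≤ A := (norm_nonneg _).trans (hbd _ hσ₀ 0)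
  -- the slices
  set S : ℝ → EuclideanSpace ℝ (Fin 3) → EuclideanSpace ℝ (Fin 3) :=
    fun σ x => ∫ y, oseenKernel (1 * (t - σ)) (x - y) (u σ y) (u σ y) with hS
  have hSm : Measurable (fun p : EuclideanSpace ℝ (Fin 3) × ℝ => ‖S p.2 p.1‖ₑ) := by
    have h := (stronglyMeasurable_oseenSlice_duhamel 1 t hum hum).measurable
    have h' := (h.comp (measurable_swap :
      Measurable (Prod.swap : EuclideanSpace ℝ (Fin 3) × ℝ → ℝ × EuclideanSpace ℝ (Fin 3)))).enorm
    have e : (fun p : EuclideanSpace ℝ (Fin 3) × ℝ => ‖S p.2 p.1‖ₑ) =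
        fun p => ‖((fun q : ℝ × EuclideanSpace ℝ (Fin 3) =>
          oseenSlice (1 * (t - q.1)) (u q.1) (u q.1) q.2) ∘ Prod.swap) p‖ₑ := by
      funext p; rfl
    rw [e]
    exact h'
  -- the integrand of Minkowski's inequality
  set f : EuclideanSpace ℝ (Fin 3) → ℝ → ℝ≥0∞ :=
    fun x σ => (Ioo s t).indicator (fun σ => ‖S σ x‖ₑ) σ with hf
  have hfm : Measurable (uncurry f) := by
    have e : uncurry f = (univ ×ˢ Ioo s t).indicator
        (fun p : EuclideanSpace ℝ (Fin 3) × ℝ => ‖S p.2 p.1‖ₑ) := by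
      funext p
      rcases p with ⟨x, σ⟩
      by_cases hσ : σ ∈ Ioo s t
      · simp [hf, uncurry, hσ]
      · simp [hf, uncurry, hσ]
    rw [e]
    exact hSm.indicator (MeasurableSet.univ.prod measurableSet_Ioo)
  -- pointwise bound of the Duhamel term by the time integral of the slice norms
  have hpt : ∀ x, ‖oseenDuhamel 1 s u u t x‖ₑ ≤ ∫⁻ σ, f x σ := by
    intro x
    rw [oseenDuhamel_apply]
    refine (enorm_integral_le_lintegral_enorm _).trans (le_of_eq ?_)
    rw [← lintegral_indicator measurableSet_Ioo]
  -- the slice norms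
  have hslice : ∀ σ ∈ Ioo s t, eLpNorm (S σ) 6 volume ≤
      ENNReal.ofReal (C * A * M₀ * (t - σ) ^ (-(1 / 2 : ℝ))) * N := by
    intro σ hσ
    have hτ : 0 < 1 * (t - σ) := by linarith [hσ.2]
    have huσ : Measurable (u σ) := hum.comp measurable_prodMk_left
    have h1 := eLpNorm_oseenSlice_six_le hC.le hK' hτ huσ (hbd σ hσ)
    have hint : ∫ z : EuclideanSpace ℝ (Fin 3), (1 * (t - σ) + ‖z‖ ^ 2) ^ (-(2 : ℝ)) =
        M₀ * (t - σ) ^ (-(1 / 2 : ℝ)) := by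
      rw [integral_add_norm_sq_rpow_neg hτ 2, finrank_euclideanSpace_fin, one_mul]
      rw [show ((3 : ℕ) : ℝ) / 2 - 2 = -(1 / 2 : ℝ) by norm_num, mul_comm]
    rw [hint] at h1
    calc eLpNorm (S σ) 6 volume
        ≤ ENNReal.ofReal (C * A * (M₀ * (t - σ) ^ (-(1 / 2 : ℝ)))) * eLpNorm (u σ) 6 volume := h1
      _ ≤ ENNReal.ofReal (C * A * M₀ * (t - σ) ^ (-(1 / 2 : ℝ))) * N := by
          rw [← mul_assoc]
          exact mul_le_mul' le_rfl (hN σ hσ)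
  -- Minkowski in `σ`
  have h6 : (6 : ℝ≥0∞).toReal = 6 := by norm_num
  have hMink := rpow_inv_lintegral_rpow_lintegral_le
    (μ := (volume : Measure (EuclideanSpace ℝ (Fin 3)))) (ν := (volume : Measure ℝ))
    (p := (6 : ℝ)) (by norm_num) hfm
  have hinner : ∀ σ, (∫⁻ x, (f x σ) ^ (6 : ℝ)) ^ (1 / (6 : ℝ)) =
      (Ioo s t).indicator (fun σ => eLpNorm (S σ) 6 volume) σ := by
    intro σ
    by_cases hσ : σ ∈ Ioo s t
    · rw [indicator_of_mem hσ, eLpNorm_eq_lintegral_rpow_enorm_toReal (by norm_num) (by norm_num), h6]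
      congr 1
      refine lintegral_congr fun x => ?_
      simp [hf, hσ]
    · rw [indicator_of_notMem hσ]
      have e : ∀ x, f x σ = 0 := fun x => by simp [hf, hσ]
      simp_rw [e, ENNReal.zero_rpow_of_pos (by norm_num : (0 : ℝ) < 6), lintegral_zero,
        ENNReal.zero_rpow_of_pos (by norm_num : (0 : ℝ) < 1 / 6)]
  -- the time integral of the weights
  have hweight : ∫⁻ σ in Ioo s t, ENNReal.ofReal (C * A * M₀ * (t - σ) ^ (-(1 / 2 : ℝ))) =
      ENNReal.ofReal (C * A * M₀ * (2 * Real.sqrt (t - s))) := by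
    rw [← ofReal_integral_eq_lintegral_ofReal ((integrableOn_Ioo_rpow_neg_half hst).const_mul _)]
    · rw [integral_const_mul, integral_Ioo_rpow_neg_half hst]
    · refine ae_restrict_of_forall_mem measurableSet_Ioo fun σ hσ => ?_
      exact mul_nonneg (by positivity) (Real.rpow_nonneg (by linarith [hσ.2]) _)
  calc eLpNorm (oseenDuhamel 1 s u u t) 6 volume
      = (∫⁻ x, ‖oseenDuhamel 1 s u u t x‖ₑ ^ (6 : ℝ)) ^ (1 / (6 : ℝ)) := by
        rw [eLpNorm_eq_lintegral_rpow_enorm_toReal (by norm_num) (by norm_num), h6]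
    _ ≤ (∫⁻ x, (∫⁻ σ, f x σ) ^ (6 : ℝ)) ^ (1 / (6 : ℝ)) := by
        gcongr with x
        exact hpt x
    _ ≤ ∫⁻ σ, (∫⁻ x, (f x σ) ^ (6 : ℝ)) ^ (1 / (6 : ℝ)) := hMink
    _ = ∫⁻ σ in Ioo s t, eLpNorm (S σ) 6 volume := by
        rw [lintegral_congr hinner, lintegral_indicator measurableSet_Ioo]
    _ ≤ ∫⁻ σ in Ioo s t, ENNReal.ofReal (C * A * M₀ * (t - σ) ^ (-(1 / 2 : ℝ))) * N :=
        setLIntegral_mono' measurableSet_Ioo fun σ hσ => hslice σ hσ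
    _ = (∫⁻ σ in Ioo s t, ENNReal.ofReal (C * A * M₀ * (t - σ) ^ (-(1 / 2 : ℝ)))) * N := by
        rw [lintegral_mul_const _ ?_]
        exact ENNReal.measurable_ofReal.comp (measurable_const.mul
          ((measurable_const.sub measurable_id).pow_const _))
    _ = ENNReal.ofReal (C * A * M₀ * (2 * Real.sqrt (t - s))) * N := by rw [hweight]
    _ ≤ ENNReal.ofReal ((2 * C * M₀ + 1) * A * Real.sqrt (t - s)) * N := by
        refine mul_le_mul' (ENNReal.ofReal_le_ofReal ?_) le_rfl
        have hsq : 0 ≤ Real.sqrt (t - s) := Real.sqrt_nonneg _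
        nlinarith [mul_nonneg hA0 hsq]

end Summit.NavierStokesRegularity.NavierStokesRegularity.Theorems.FiniteDissipationLiouville.Birth

end
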